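import Summits.BirchSwinnertonDyer.BirchSwinnertonDyer.Theorems.SylvesterTwoHeegnerIndexShaDescentPackage
import Literature.NumberTheory.EllipticCurves.SelmerTorsionCMOperatorJZero
import HarnessLib

/-!
# The COUPLED Cassels–Tate telescope, XIII: the ONE-φ PACKAGE — the complex multiplication `[ζ]`
# carrying the `Ш[2^∞]`-level operator `w`, the descent datum `(r, s)` AND the Selmer-level operator
# `w_S` on `H¹(K, E[n])` (tree-currency instantiation lane, planner D620 (b))

Crux `UpperOffV0HSYPlus` (stmt-BirchSwinnertonDyer-19804), skeleton VARIANT M, display hT^κ =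
`…CoupledTelescopeTailFourKappa` (p704180) l.89–236.  The generic-witness bricks of the TAIL
(#K8′ p701264 Lagrangian, #K10 p705415 lift family, #K11 p705565 supply, #K12 p706296 isotropy) take
the `Ш(E_K)[2^∞]`-level `𝒪`-operator `wM` AND the `H¹(K, E[n])`-level operator `wS` as binders GLUED
by `hτw : τ s = ι a → τ (wS s) = ι (wM a)`.  The tree has each operator separately
(`SylvesterTwoShaDescentOrderForm.exists_descent_package`: `(φ, r, w, s)` on `Ш[2^∞]`;
`JZero.exists_cm_operator_galH1Torsion`: `(φ, w)` on `H¹(K, E_K[n])`), but as two `∃`-statements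
over two un-pinned isogenies they cannot be glued.  This file builds BOTH from ONE isogeny
`φ = [ζ] : (x, y) ↦ (ζ² x, ζ³ y)` (`SylvesterTwoShaConjugation.exists_cm_isogeny_of_eq`, with
`φ² + φ + 1 = 0` on `E(K̄)` — the one source of the relation at both levels):

* `exists_onePhi_package` — for `E = W/ℚ` a `j = 0` short model, `K` totally complex quadratic with a
  primitive cube root `ζ`, `σ ζ = ζ²`, `σ² = 1`, and ANY `n : ℤ`: `∃ φ fn hfn r w s` with `φ` PINNED
  (action on affine points + point relation), `fn = φ|E[n]` (`↑(fn P) = φ ↑P`), the ELEVEN clauses of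
  `exists_descent_package` for `(φ, r, w, s)` verbatim, and for the Selmer-level operator — the
  TERM `w_S := resH1Hom (ContinuousMonoidHom.id _) fn hfn` (no `∃`: fully pinned) — (i) `w_S` lies
  over `galH1Map φ` through `torsionH1ToH1`, (ii) `w_S² + w_S + 1 = 0`, (iii) `w_S` preserves
  `selmerGroup (W⁄K) n`;
* `hτw_of_torsionH1ToH1_eq` — #K10's gluing binder `hτw` as a THEOREM for this package
  (`ι := sha.subtype ∘ primaryComponent.subtype`, `τ := torsionH1ToH1`);
* `exists_onePhi_package_of_omega` — binder form (`ω² + ω + 1 = 0`, `finrank ℚ K = 2`) on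
  `⟨0, 0, 0, 0, b⟩`, the currency of hT^κ.

Proof = `exists_lemmaD_data` + `exists_descent_package` (g19 / #K7) re-run on THIS `φ`, and the
Literature generics `torsionH1ToH1_resH1Hom_id` / `resH1Hom_id_apply_apply_add` /
`resH1Hom_id_mem_selmerGroup` (from which `JZero.exists_cm_operator_galH1Torsion` is itself assembled)
on `fn := codRestrict (φ ∘ subtype)`.  Theorem-only (no definition, no named fact); nothing asserted
on 19804; no stub closed; X12.CMAtTwo NOT proved; BSD not claimed for any curve.  Sources: Gross 1991
§5 (5.1); Milne ADT I §6; Silverman AEC III.10.1; Serre, Galois Cohomology I.§2.4; MEMO-bsd-cm-two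
§57.1, §59.1 (iii), §64.5.
-/

-- every Summits module is named `Summit.<Summit>.<Problem>…`: the duplicated component is by design
set_option linter.dupNamespace false
set_option autoImplicit false

noncomputable section

open scoped Classical

open WeierstrassCurve Literature.NumberTheory.EllipticCurves
  Literature.NumberTheory.GaloisRepresentations NumberField

namespace Summit.BirchSwinnertonDyer.BirchSwinnertonDyer.Theorems.SylvesterTwoCoupledTelescope

section OnePhi

variable (W : WeierstrassCurve ℚ) [W.IsElliptic] (K : Type) [Field K] [NumberField K]
variable {σ : K ≃ₐ[ℚ] K}

set_option maxHeartbeats 400000 in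
/-- **THE ONE-φ PACKAGE** (module docstring): the complex multiplication `φ = [ζ]` of a `j = 0` short
model over a totally complex quadratic `K ∋ ζ`, PINNED by its action `(x, y) ↦ (ζ² x, ζ³ y)` and its
point relation `φ² + φ + 1 = 0`, its restriction `fn = φ|E[n]`, and on it: the descent datum
`(r, w, s)` on `Ш(E_K/K)[2^∞]` with the eleven clauses of `exists_descent_package`, and the
Selmer-level operator `w_S = resH1Hom id fn hfn` on `H¹(K, E_K[n])` lying over `galH1Map φ`, with
`w_S² + w_S + 1 = 0`, preserving `Sel_n(E_K/K)`.  Gross 1991 §5 (5.1) (the `Gal(K/ℚ)`-semilinear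
`𝒪`-structure); Milne ADT I §6 (functoriality of Selmer conditions). [cite: GrossLMS1991, §5 (5.1)]
[cite: MilneADT2006, Ch. I §6 p. 75] [cite: SilvermanAEC2009, Thm. III.10.1 and Cor. III.10.2] -/
theorem exists_onePhi_package (hK : ∀ v : InfinitePlace K, v.IsComplex) (hσ2 : σ * σ = 1)
    (ha₁ : W.a₁ = 0) (ha₂ : W.a₂ = 0) (ha₃ : W.a₃ = 0) (ha₄ : W.a₄ = 0)
    (h2 : Module.finrank ℚ K = 2) {ζ : K} (hζ : IsPrimitiveRoot ζ 3) (hσζ : σ ζ = ζ ^ 2) (n : ℤ) :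
    ∃ (φ : Isogeny (W.baseChange K) (W.baseChange K))
      (fn : geomTorsion (W.baseChange K) n →+ geomTorsion (W.baseChange K) n)
      (hfn : ∀ (g : Field.absoluteGaloisGroup K) (P : geomTorsion (W.baseChange K) n),
        fn (ContinuousMonoidHom.id _ g • P) = g • fn P)
      (r : AddCommGroup.primaryComponent W.sha 2 →+
        AddCommGroup.primaryComponent (W.baseChange K).sha 2)
      (w s : AddCommGroup.primaryComponent (W.baseChange K).sha 2 →+
        AddCommGroup.primaryComponent (W.baseChange K).sha 2),
      -- `φ` PINNED: action on affine points, and the point relation `φ² + φ + 1 = 0`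
      (∀ (x y : AlgebraicClosure K)
        (h : ((W.baseChange K).baseChange (AlgebraicClosure K)).toAffine.Nonsingular x y),
        ∃ h', φ (Affine.Point.some x y h) =
          Affine.Point.some (algebraMap K (AlgebraicClosure K) ζ ^ 2 * x)
            (algebraMap K (AlgebraicClosure K) ζ ^ 3 * y) h') ∧
      (∀ P, φ (φ P) + φ P + P = 0) ∧
      (∀ P : geomTorsion (W.baseChange K) n,
        ((fn P : geomTorsion (W.baseChange K) n) : geomPoints (W.baseChange K)) = φ P) ∧
      -- the descent datum `(r, w, s)` on `Ш(E_K/K)[2^∞]` (clauses of `exists_descent_package`)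
      (∀ c, ((r c : AddCommGroup.primaryComponent (W.baseChange K).sha 2) :
        (W.baseChange K).sha) = shaRestriction W K c) ∧
      (∀ x, (((w x : AddCommGroup.primaryComponent (W.baseChange K).sha 2) :
          (W.baseChange K).sha) : (W.baseChange K).galH1) =
        galH1Map φ.toAddMonoidHom φ.equivariant ((x : (W.baseChange K).sha) : (W.baseChange K).galH1)) ∧
      (∀ x, (((s x : AddCommGroup.primaryComponent (W.baseChange K).sha 2) :
          (W.baseChange K).sha) : (W.baseChange K).galH1) =
        (isLiftOfAut_liftAut σ).conjH1Points W ((x : (W.baseChange K).sha) : (W.baseChange K).galH1)) ∧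
      (∀ x, w (w x) + w x + x = 0) ∧ (∀ x, s (s x) = x) ∧ (∀ x, s (w x) = -(s x) - w (s x)) ∧
      (Function.Bijective fun x : AddCommGroup.primaryComponent (W.baseChange K).sha 2 =>
        (3 : ℤ) • x) ∧
      (∀ c, s (r c) = r c) ∧ (∀ y, s y = y → ∃ c, r c = y) ∧ Function.Injective r ∧
      (Function.Bijective fun cd : AddCommGroup.primaryComponent W.sha 2 ×
          AddCommGroup.primaryComponent W.sha 2 ↦ r cd.1 + w (r cd.2)) ∧
      -- the Selmer-level operator `w_S := resH1Hom id fn hfn` on `H¹(K, E_K[n])`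
      (∀ c, torsionH1ToH1 (W.baseChange K) n (resH1Hom (ContinuousMonoidHom.id _) fn hfn c) =
        galH1Map φ.toAddMonoidHom φ.equivariant (torsionH1ToH1 (W.baseChange K) n c)) ∧
      (∀ c, resH1Hom (ContinuousMonoidHom.id _) fn hfn (resH1Hom (ContinuousMonoidHom.id _) fn hfn c) +
        resH1Hom (ContinuousMonoidHom.id _) fn hfn c + c = 0) ∧
      (∀ c ∈ selmerGroup (W.baseChange K) n,
        resH1Hom (ContinuousMonoidHom.id _) fn hfn c ∈ selmerGroup (W.baseChange K) n) := by
  -- ### the ONE isogeny `φ = [ζ]`, pinned, with its point relation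
  obtain ⟨φ, hφ, hrel⟩ := SylvesterTwoShaConjugation.exists_cm_isogeny_of_eq (V := W.baseChange K)
    (SylvesterTwoShaDescentOrderForm.baseChange_eq_of_a_eq_zero W K ha₁ ha₂ ha₃ ha₄) hζ
  -- ### its restriction to `E[n]`
  let fn : geomTorsion (W.baseChange K) n →+ geomTorsion (W.baseChange K) n :=
    (φ.toAddMonoidHom.comp (geomTorsion (W.baseChange K) n).subtype).codRestrict _ fun P ↦ by
      simp only [AddMonoidHom.coe_comp, AddSubgroup.coe_subtype, Function.comp_apply]
      rw [mem_geomTorsion_iff, ← map_zsmul, (mem_geomTorsion_iff _ n _).mp P.2, map_zero]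
  have hcoe : ∀ P : geomTorsion (W.baseChange K) n,
      ((fn P : geomTorsion (W.baseChange K) n) : geomPoints (W.baseChange K)) = φ P :=
    fun _ ↦ rfl
  have hfn : ∀ (g : Field.absoluteGaloisGroup K) (P : geomTorsion (W.baseChange K) n),
      fn (ContinuousMonoidHom.id _ g • P) = g • fn P := by
    intro g P
    apply Subtype.ext
    rw [hcoe, AddSubgroup.torsionBy.coe_smul, AddSubgroup.torsionBy.coe_smul, hcoe]
    exact φ.equivariant g P
  have hreln : ∀ P : geomTorsion (W.baseChange K) n, fn (fn P) + fn P + P = 0 := by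
    intro P
    apply Subtype.ext
    change ((fn (fn P) : geomTorsion (W.baseChange K) n) : geomPoints (W.baseChange K)) +
      ((fn P : geomTorsion (W.baseChange K) n) : geomPoints (W.baseChange K)) + P = 0
    exact hrel P
  -- ### the `Ш`-level data `(w, s)` on THIS `φ` (re-run of `exists_lemmaD_data`)
  have hwSha := SylvesterTwoShaOmegaAction.shaMap_shaMap_add_shaMap_add_self_eq_zero
    φ.toAddMonoidHom φ.equivariant φ.hasLocalPointsMaps_toAddMonoidHom hrel
  obtain ⟨w, hw⟩ := SylvesterTwoShaOmegaAction.exists_restrict_primaryComponent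
    (shaMap φ.toAddMonoidHom φ.equivariant φ.hasLocalPointsMaps_toAddMonoidHom) 2
  let sSha : (W.baseChange K).sha →+ (W.baseChange K).sha :=
    (((isLiftOfAut_liftAut σ).conjH1Points W).comp (W.baseChange K).sha.subtype).codRestrict _
      fun c ↦ SylvesterTwoShaConjugation.conjH1Points_mem_sha W hK (isLiftOfAut_liftAut σ) c.2
  have hsSha : ∀ c : (W.baseChange K).sha, ((sSha c : (W.baseChange K).sha) : (W.baseChange K).galH1)
      = (isLiftOfAut_liftAut σ).conjH1Points W c := fun _ ↦ rfl
  obtain ⟨s, hs⟩ := SylvesterTwoShaOmegaAction.exists_restrict_primaryComponent sSha 2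
  have hwφ : ∀ x, (((w x : AddCommGroup.primaryComponent (W.baseChange K).sha 2) :
      (W.baseChange K).sha) : (W.baseChange K).galH1) =
      galH1Map φ.toAddMonoidHom φ.equivariant ((x : (W.baseChange K).sha) : (W.baseChange K).galH1) :=
    fun x ↦ by rw [hw, coe_shaMap_apply]
  have hsτ : ∀ x, (((s x : AddCommGroup.primaryComponent (W.baseChange K).sha 2) :
      (W.baseChange K).sha) : (W.baseChange K).galH1) =
      (isLiftOfAut_liftAut σ).conjH1Points W ((x : (W.baseChange K).sha) : (W.baseChange K).galH1) :=
    fun x ↦ by rw [hs, hsSha]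
  have hwrel : ∀ x, w (w x) + w x + x = 0 := SylvesterTwoShaOmegaAction.restrict_relation hw hwSha
  have hss : ∀ x, s (s x) = x := fun x ↦ by
    apply Subtype.ext
    apply Subtype.ext
    rw [hs, hsSha, hs, hsSha]
    exact SylvesterTwoShaConjugation.conjH1Points_conjH1Points_of_mul_self W hσ2
      (isLiftOfAut_liftAut σ) _
  have hsw : ∀ x, s (w x) = -(s x) - w (s x) := fun x ↦ by
    apply Subtype.ext
    apply Subtype.ext
    have e := SylvesterTwoShaConjugation.conjH1Points_galH1Map_add W (isLiftOfAut_liftAut σ) hσζ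
      φ.toAddMonoidHom φ.equivariant hφ hrel ((x : (W.baseChange K).sha) : (W.baseChange K).galH1)
    rw [add_assoc, add_eq_zero_iff_eq_neg, neg_add, ← sub_eq_add_neg] at e
    rw [AddSubgroupClass.coe_sub, AddSubgroupClass.coe_sub, NegMemClass.coe_neg,
      NegMemClass.coe_neg, hs, hsSha, hw, coe_shaMap_apply, hw, coe_shaMap_apply, hs, hsSha, e]
    abel
  have h3 : Function.Bijective fun x : AddCommGroup.primaryComponent (W.baseChange K).sha 2 =>
      (3 : ℤ) • x :=
    SylvesterTwoUnramifiedDescent.three_zsmul_bijective_of_two_primary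
      SylvesterTwoShaOmegaAction.exists_two_zpow_smul_eq_zero
  -- ### the descent datum `r` and the bijection (re-run of `exists_descent_package`)
  have hdesc := SylvesterTwoUnramifiedDescent.descent_bijective w s hwrel hss hsw h3
  have hinj := JZero.shaRestriction_injective_of_isPrimitiveRoot W K ha₁ ha₂ ha₃ ha₄ h2 hζ hσζ
  let r : AddCommGroup.primaryComponent W.sha 2 →+
      AddCommGroup.primaryComponent (W.baseChange K).sha 2 :=
    ((shaRestriction W K).comp (AddCommGroup.primaryComponent W.sha 2).subtype).codRestrict _
      fun c ↦ map_mem_primaryComponent (shaRestriction W K) c.2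
  have hr : ∀ c, ((r c : AddCommGroup.primaryComponent (W.baseChange K).sha 2) :
      (W.baseChange K).sha) = shaRestriction W K c := fun _ ↦ rfl
  have hsr : ∀ c, s (r c) = r c := by
    intro c
    apply Subtype.ext
    apply Subtype.ext
    rw [hsτ, hr, conjH1Points_shaRestriction]
  have hrinj : Function.Injective r := by
    intro c c' h
    have h' : shaRestriction W K c = shaRestriction W K c' := by
      rw [← hr, ← hr, show r c = r c' from h]
    exact Subtype.ext (hinj h')
  have hronto : ∀ y, s y = y → ∃ c, r c = y := by
    intro y hy
    have hinv : (isLiftOfAut_liftAut σ).conjH1Points W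
        (((y : AddCommGroup.primaryComponent (W.baseChange K).sha 2) : (W.baseChange K).sha) :
          (W.baseChange K).galH1) = (y : (W.baseChange K).sha) := by
      rw [← hsτ, hy]
    obtain ⟨s₀, hs₀⟩ :=
      JZero.exists_shaRestriction_eq_of_conjH1Points_eq K W ha₁ ha₂ ha₃ ha₄ h2 hζ hσζ hinv
    have hs₀mem : s₀ ∈ AddCommGroup.primaryComponent W.sha 2 := by
      obtain ⟨k, hk⟩ := AddCommGroup.mem_primaryComponent.mp y.2
      refine AddCommGroup.mem_primaryComponent.mpr ⟨k, hinj ?_⟩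
      rw [map_nsmul, hs₀, map_zero]
      exact hk
    exact ⟨⟨s₀, hs₀mem⟩, Subtype.ext hs₀⟩
  have hker : ∀ c, r c ∈ (s - AddMonoidHom.id _).ker := by
    intro c
    rw [AddMonoidHom.mem_ker, AddMonoidHom.sub_apply, AddMonoidHom.id_apply, sub_eq_zero]
    exact hsr c
  let r' : AddCommGroup.primaryComponent W.sha 2 →+ (s - AddMonoidHom.id _).ker :=
    r.codRestrict _ hker
  have hbij' : Function.Bijective r' := by
    refine ⟨fun c c' h ↦ hrinj (congrArg Subtype.val h), ?_⟩
    rintro ⟨y, hy⟩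
    have hy' : s y = y := by
      rw [AddMonoidHom.mem_ker, AddMonoidHom.sub_apply, AddMonoidHom.id_apply, sub_eq_zero] at hy
      exact hy
    obtain ⟨c, hc⟩ := hronto y hy'
    exact ⟨c, Subtype.ext hc⟩
  have hbij : Function.Bijective fun cd : AddCommGroup.primaryComponent W.sha 2 ×
      AddCommGroup.primaryComponent W.sha 2 ↦ r cd.1 + w (r cd.2) := by
    have hcomp : (fun cd : AddCommGroup.primaryComponent W.sha 2 ×
        AddCommGroup.primaryComponent W.sha 2 ↦ r cd.1 + w (r cd.2)) =
        (fun st : (s - AddMonoidHom.id _).ker × (s - AddMonoidHom.id _).ker ↦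
          (st.1 : AddCommGroup.primaryComponent (W.baseChange K).sha 2) + w st.2) ∘
        (fun cd ↦ (r' cd.1, r' cd.2)) := rfl
    rw [hcomp]
    exact hdesc.comp ⟨fun a b h ↦ Prod.ext (hbij'.1 (Prod.mk.inj h).1) (hbij'.1 (Prod.mk.inj h).2),
      fun st ↦ ⟨((hbij'.2 st.1).choose, (hbij'.2 st.2).choose),
        Prod.ext (hbij'.2 st.1).choose_spec (hbij'.2 st.2).choose_spec⟩⟩
  -- ### assembly, with the Selmer-level generics on `fn`
  have hS1 : ∀ c, torsionH1ToH1 (W.baseChange K) n (resH1Hom (ContinuousMonoidHom.id _) fn hfn c) =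
      galH1Map φ.toAddMonoidHom φ.equivariant (torsionH1ToH1 (W.baseChange K) n c) :=
    torsionH1ToH1_resH1Hom_id n fn hfn φ.toAddMonoidHom φ.equivariant hcoe
  have hS2 : ∀ c, resH1Hom (ContinuousMonoidHom.id _) fn hfn
      (resH1Hom (ContinuousMonoidHom.id _) fn hfn c) + resH1Hom (ContinuousMonoidHom.id _) fn hfn c +
      c = 0 :=
    resH1Hom_id_apply_apply_add n fn hfn hreln
  have hS3 : ∀ c ∈ selmerGroup (W.baseChange K) n,
      resH1Hom (ContinuousMonoidHom.id _) fn hfn c ∈ selmerGroup (W.baseChange K) n :=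
    fun c hc ↦ resH1Hom_id_mem_selmerGroup n fn hfn φ.toAddMonoidHom hcoe
      φ.hasLocalPointsMaps_toAddMonoidHom hc
  refine ⟨φ, fn, hfn, r, w, s, hφ, hrel, hcoe, hr, hwφ, hsτ, hwrel, hss, hsw, h3, hsr, hronto, hrinj,
    hbij, hS1, hS2, hS3⟩

omit [W.IsElliptic] in
/-- **#K10's gluing binder `hτw` as a THEOREM for the one-φ package**: if the Selmer-level
operator lies over `galH1Map φ` through `τ = torsionH1ToH1` (clause (i)) and the `Ш[2^∞]`-level `w`
lies over `galH1Map φ` through the inclusion `ι : Ш(E_K)[2^∞] ↪ H¹(K, E_K)` (clause `hw`), then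
`τ c = ι a → τ (w_S c) = ι (w a)`. [cite: SerreGaloisCohomology1997, I.§2.4] -/
theorem hτw_of_torsionH1ToH1_eq {n : ℤ} {φ : Isogeny (W.baseChange K) (W.baseChange K)}
    (wS : galH1Torsion (W.baseChange K) n →+ galH1Torsion (W.baseChange K) n)
    (hwS : ∀ c, torsionH1ToH1 (W.baseChange K) n (wS c) =
      galH1Map φ.toAddMonoidHom φ.equivariant (torsionH1ToH1 (W.baseChange K) n c))
    (w : AddCommGroup.primaryComponent (W.baseChange K).sha 2 →+
      AddCommGroup.primaryComponent (W.baseChange K).sha 2)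
    (hw : ∀ x, (((w x : AddCommGroup.primaryComponent (W.baseChange K).sha 2) :
        (W.baseChange K).sha) : (W.baseChange K).galH1) =
      galH1Map φ.toAddMonoidHom φ.equivariant ((x : (W.baseChange K).sha) : (W.baseChange K).galH1)) :
    ∀ c ∈ selmerGroup (W.baseChange K) n, ∀ a : AddCommGroup.primaryComponent (W.baseChange K).sha 2,
      torsionH1ToH1 (W.baseChange K) n c =
          ((W.baseChange K).sha.subtype.comp (AddCommGroup.primaryComponent (W.baseChange K).sha 2).subtype)
            a →
        torsionH1ToH1 (W.baseChange K) n (wS c) =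
          ((W.baseChange K).sha.subtype.comp (AddCommGroup.primaryComponent (W.baseChange K).sha 2).subtype)
            (w a) := by
  intro c _ a h
  rw [hwS, h, AddMonoidHom.coe_comp, AddSubgroup.coe_subtype, AddSubgroup.coe_subtype,
    Function.comp_apply, Function.comp_apply, hw]

/-- **The one-φ package, binder form** (`ω² + ω + 1 = 0`, `finrank ℚ K = 2`) on a `j = 0` short model
`⟨0, 0, 0, 0, b⟩` (`= cubeSumCurve ·` by `rfl`), the currency of the census display hT^κ: the
involution `σ` with `σ ω = ω²`, total complexity and `ζ := ω` come from `JZero.exists_aut_apply_eq_sq`.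
[cite: GrossLMS1991, §5 (5.1)] [cite: MilneADT2006, Ch. I §6 p. 75] -/
theorem exists_onePhi_package_of_omega {b : ℚ} [(⟨0, 0, 0, 0, b⟩ : WeierstrassCurve ℚ).IsElliptic]
    {ω : K} (hω : ω ^ 2 + ω + 1 = 0) (h2 : Module.finrank ℚ K = 2) (n : ℤ) :
    ∃ (σ : K ≃ₐ[ℚ] K) (_ : σ ω = ω ^ 2) (_ : σ * σ = 1)
      (φ : Isogeny ((⟨0, 0, 0, 0, b⟩ : WeierstrassCurve ℚ).baseChange K)
        ((⟨0, 0, 0, 0, b⟩ : WeierstrassCurve ℚ).baseChange K))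
      (fn : geomTorsion ((⟨0, 0, 0, 0, b⟩ : WeierstrassCurve ℚ).baseChange K) n →+
        geomTorsion ((⟨0, 0, 0, 0, b⟩ : WeierstrassCurve ℚ).baseChange K) n)
      (hfn : ∀ (g : Field.absoluteGaloisGroup K)
        (P : geomTorsion ((⟨0, 0, 0, 0, b⟩ : WeierstrassCurve ℚ).baseChange K) n),
        fn (ContinuousMonoidHom.id _ g • P) = g • fn P)
      (r : AddCommGroup.primaryComponent (⟨0, 0, 0, 0, b⟩ : WeierstrassCurve ℚ).sha 2 →+
        AddCommGroup.primaryComponent ((⟨0, 0, 0, 0, b⟩ : WeierstrassCurve ℚ).baseChange K).sha 2)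
      (w s : AddCommGroup.primaryComponent ((⟨0, 0, 0, 0, b⟩ : WeierstrassCurve ℚ).baseChange K).sha 2
        →+ AddCommGroup.primaryComponent ((⟨0, 0, 0, 0, b⟩ : WeierstrassCurve ℚ).baseChange K).sha 2),
      (∀ (x y : AlgebraicClosure K)
        (h : (((⟨0, 0, 0, 0, b⟩ : WeierstrassCurve ℚ).baseChange K).baseChange
          (AlgebraicClosure K)).toAffine.Nonsingular x y),
        ∃ h', φ (Affine.Point.some x y h) =
          Affine.Point.some (algebraMap K (AlgebraicClosure K) ω ^ 2 * x)
            (algebraMap K (AlgebraicClosure K) ω ^ 3 * y) h') ∧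
      (∀ P, φ (φ P) + φ P + P = 0) ∧
      (∀ P : geomTorsion ((⟨0, 0, 0, 0, b⟩ : WeierstrassCurve ℚ).baseChange K) n,
        ((fn P : geomTorsion ((⟨0, 0, 0, 0, b⟩ : WeierstrassCurve ℚ).baseChange K) n) :
          geomPoints ((⟨0, 0, 0, 0, b⟩ : WeierstrassCurve ℚ).baseChange K)) = φ P) ∧
      (∀ c, ((r c : AddCommGroup.primaryComponent
          ((⟨0, 0, 0, 0, b⟩ : WeierstrassCurve ℚ).baseChange K).sha 2) :
        ((⟨0, 0, 0, 0, b⟩ : WeierstrassCurve ℚ).baseChange K).sha) =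
          shaRestriction (⟨0, 0, 0, 0, b⟩ : WeierstrassCurve ℚ) K c) ∧
      (∀ x, (((w x : AddCommGroup.primaryComponent
          ((⟨0, 0, 0, 0, b⟩ : WeierstrassCurve ℚ).baseChange K).sha 2) :
          ((⟨0, 0, 0, 0, b⟩ : WeierstrassCurve ℚ).baseChange K).sha) :
            ((⟨0, 0, 0, 0, b⟩ : WeierstrassCurve ℚ).baseChange K).galH1) =
        galH1Map φ.toAddMonoidHom φ.equivariant
          ((x : ((⟨0, 0, 0, 0, b⟩ : WeierstrassCurve ℚ).baseChange K).sha) :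
            ((⟨0, 0, 0, 0, b⟩ : WeierstrassCurve ℚ).baseChange K).galH1)) ∧
      (∀ x, (((s x : AddCommGroup.primaryComponent
          ((⟨0, 0, 0, 0, b⟩ : WeierstrassCurve ℚ).baseChange K).sha 2) :
          ((⟨0, 0, 0, 0, b⟩ : WeierstrassCurve ℚ).baseChange K).sha) :
            ((⟨0, 0, 0, 0, b⟩ : WeierstrassCurve ℚ).baseChange K).galH1) =
        (isLiftOfAut_liftAut σ).conjH1Points (⟨0, 0, 0, 0, b⟩ : WeierstrassCurve ℚ)
          ((x : ((⟨0, 0, 0, 0, b⟩ : WeierstrassCurve ℚ).baseChange K).sha) :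
            ((⟨0, 0, 0, 0, b⟩ : WeierstrassCurve ℚ).baseChange K).galH1)) ∧
      (∀ x, w (w x) + w x + x = 0) ∧ (∀ x, s (s x) = x) ∧ (∀ x, s (w x) = -(s x) - w (s x)) ∧
      (Function.Bijective fun x : AddCommGroup.primaryComponent
        ((⟨0, 0, 0, 0, b⟩ : WeierstrassCurve ℚ).baseChange K).sha 2 => (3 : ℤ) • x) ∧
      (∀ c, s (r c) = r c) ∧ (∀ y, s y = y → ∃ c, r c = y) ∧ Function.Injective r ∧
      (Function.Bijective fun cd : AddCommGroup.primaryComponent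
          (⟨0, 0, 0, 0, b⟩ : WeierstrassCurve ℚ).sha 2 ×
        AddCommGroup.primaryComponent (⟨0, 0, 0, 0, b⟩ : WeierstrassCurve ℚ).sha 2 ↦
          r cd.1 + w (r cd.2)) ∧
      (∀ c, torsionH1ToH1 ((⟨0, 0, 0, 0, b⟩ : WeierstrassCurve ℚ).baseChange K) n
          (resH1Hom (ContinuousMonoidHom.id _) fn hfn c) =
        galH1Map φ.toAddMonoidHom φ.equivariant
          (torsionH1ToH1 ((⟨0, 0, 0, 0, b⟩ : WeierstrassCurve ℚ).baseChange K) n c)) ∧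
      (∀ c, resH1Hom (ContinuousMonoidHom.id _) fn hfn (resH1Hom (ContinuousMonoidHom.id _) fn hfn c) +
        resH1Hom (ContinuousMonoidHom.id _) fn hfn c + c = 0) ∧
      (∀ c ∈ selmerGroup ((⟨0, 0, 0, 0, b⟩ : WeierstrassCurve ℚ).baseChange K) n,
        resH1Hom (ContinuousMonoidHom.id _) fn hfn c ∈
          selmerGroup ((⟨0, 0, 0, 0, b⟩ : WeierstrassCurve ℚ).baseChange K) n) := by
  obtain ⟨hζ, hK, σ, hσζ, hσ2⟩ := JZero.exists_aut_apply_eq_sq K hω h2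
  obtain ⟨φ, fn, hfn, r, w, s, h⟩ :=
    exists_onePhi_package ⟨0, 0, 0, 0, b⟩ K hK hσ2 rfl rfl rfl rfl h2 hζ hσζ n
  exact ⟨σ, hσζ, hσ2, φ, fn, hfn, r, w, s, h⟩

end OnePhi

end Summit.BirchSwinnertonDyer.BirchSwinnertonDyer.Theorems.SylvesterTwoCoupledTelescope

end
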